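import Mathlib
import Summits.KontsevichZagierPeriods.Zeta5Search.Families.BasicLimit
import HarnessLib

/-!
# ζ(5) search — Families: the GROWTH CONSTANT of the basic cellular integrals — `I_σ(N)^{1/N} → M_σ = sup f_σ`

HONEST FRAMING: systematic search; no irrationality claim unless certified.  STRUCTURAL facts about the size of
Brown's basic cellular integrals `I_σ(N) = ∫_{S_n} f_σ^N ω_σ` [Brown2016, §1.5 (1.3)–(1.4)] (seat P2, Families layer);
nothing about the arithmetic of any zeta value.

`Families/BasicMonotone.lean` / `Families/BasicLimit.lean` proved `0 < f_σ ≤ 1` on the open simplex, `I_σ(N)`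
non-increasing, and `I_σ(N) → 0` WITHOUT a rate.  This file names the rate.  For a bijective seating `σ` put
**`M_σ := sup_{S} f_σ`** (`fSup σ`, the supremum of Brown's function over the open simplex; `0 < M_σ ≤ 1`).  Then for
every CONVERGENT `σ`:
* `integral_basic_le_fSup_pow` — the trivial bound `I_σ(N) ≤ M_σ^N · I_σ(0)` (all `N ∈ ℕ`);
* `superlevel_integral_le` / `superlevel_integral_pos` — for `0 ≤ c < M_σ` the superlevel set `{f_σ > c}` is a
  non-empty OPEN subset of the simplex (continuity of `f_σ`), of positive volume, and `c^N · ∫_{f_σ > c} ω_σ ≤ I_σ(N)`;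
* **`tendsto_integral_basic_root`** — `I_σ(N)^{1/N} → M_σ` as `N → ∞` (squeeze between `c · J_c^{1/N}` and
  `M_σ · I_σ(0)^{1/N}`), i.e. the size of the basic cellular integrals is `M_σ^{N + o(N)}`: the decay exponent of the
  family is the variational quantity `−log M_σ` (`tendsto_log_integral_basic_div`: `(log I_σ(N))/N → log M_σ`).
This is the elementary `‖f‖_{L^N(μ)} → ‖f‖_{L^∞(μ)}` principle for the finite measure `μ = ω_σ dt` and the continuous
positive function `f_σ`; for Brown's `N = 5, 6` examples `M_σ = ((√5−1)/2)^5` resp. `(√2−1)^4` (Beukers' maxima; not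
proved here).  That `M_σ < 1` for convergent `σ` (genuine exponential decay) is the subject of the sequel
(`Families/BasicGrowthBounds.lean`: `f_σ ≤ 1/2`).  Standard axioms only.
-/

noncomputable section

open MeasureTheory Set Finset Filter Topology

namespace Summit.KontsevichZagierPeriods.Zeta5Search.Families.Cellular

variable {ℓ : ℕ} (σ : Fin (ℓ + 3) → Fin (ℓ + 3))

/-! ### Continuity of `f_σ` on the open simplex -/

/-- Every edge factor `ef t u v` depends continuously on `t`. -/
theorem continuous_ef (u v : Fin (ℓ + 3)) : Continuous fun t : Fin ℓ → ℝ => ef t u v := by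
  unfold ef
  split_ifs
  · exact continuous_const
  · exact (continuous_pt _).sub (continuous_pt _)

/-- The coefficient `∏_i (z_{σ_i} − z_{σ_{i+1}})` of the cellular form is continuous in `t`. -/
theorem continuous_formDen : Continuous fun t : Fin ℓ → ℝ => formDen σ t :=
  continuous_finsetProd _ fun i _ => continuous_ef (σ i) (σ (i + 1))

/-- Brown's function `f_σ` is continuous on the open simplex (for injective `σ`: the denominator does not vanish). -/
theorem continuousOn_fSigma (hσi : Function.Injective σ) : ContinuousOn (fSigma σ) (openSimplex ℓ) := by
  have hnum : Continuous fun t : Fin ℓ → ℝ => ∏ i : Fin (ℓ + 3), ef t i (i + 1) :=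
    continuous_finsetProd _ fun i _ => continuous_ef i (i + 1)
  change ContinuousOn (fun t => (∏ i : Fin (ℓ + 3), ef t i (i + 1)) / formDen σ t) (openSimplex ℓ)
  exact hnum.continuousOn.div (continuous_formDen σ).continuousOn fun t ht =>
    (Finset.prod_pos fun i _ => ef_pos ht fun e => succ_ne_self i (hσi e)).ne'

/-! ### The growth constant `M_σ = sup f_σ` -/

/-- **The growth constant of the configuration `σ`**: `M_σ = sup_{t ∈ S} f_σ(t)`, the supremum of Brown's function
`f_σ = ∏_i (z_i − z_{i+1}) / ∏_i (z_{σ_i} − z_{σ_{i+1}})` over the open simplex. [Brown2016, §1.5 (1.3); structural] -/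
def fSup : ℝ := sSup (fSigma σ '' openSimplex ℓ)

/-- The open simplex is non-empty (it has positive volume). -/
theorem openSimplex_nonempty (ℓ : ℕ) : (openSimplex ℓ).Nonempty :=
  nonempty_of_measure_ne_zero (volume_openSimplex_ne_zero ℓ)

/-- The values of `f_σ` on the simplex are bounded above (by `1`). -/
theorem bddAbove_fSigma_image (hσ : Function.Bijective σ) : BddAbove (fSigma σ '' openSimplex ℓ) :=
  ⟨1, by rintro _ ⟨t, ht, rfl⟩; exact fSigma_le_one σ hσ ht⟩

/-- `f_σ(t) ≤ M_σ` at every point of the open simplex. -/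
theorem fSigma_le_fSup (hσ : Function.Bijective σ) {t : Fin ℓ → ℝ} (ht : t ∈ openSimplex ℓ) :
    fSigma σ t ≤ fSup σ :=
  le_csSup (bddAbove_fSigma_image σ hσ) ⟨t, ht, rfl⟩

/-- `M_σ ≤ 1`. -/
theorem fSup_le_one (hσ : Function.Bijective σ) : fSup σ ≤ 1 :=
  csSup_le ((openSimplex_nonempty ℓ).image _) (by rintro _ ⟨t, ht, rfl⟩; exact fSigma_le_one σ hσ ht)

/-- `0 < M_σ`. -/
theorem fSup_pos (hσ : Function.Bijective σ) : 0 < fSup σ := by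
  obtain ⟨t, ht⟩ := openSimplex_nonempty ℓ
  exact (fSigma_pos σ hσ.1 ht).trans_le (fSigma_le_fSup σ hσ ht)

/-- Below the supremum there are points of the simplex: `c < M_σ ⇒ ∃ t ∈ S, c < f_σ(t)`. -/
theorem exists_lt_fSigma {c : ℝ} (hc : c < fSup σ) :
    ∃ t ∈ openSimplex ℓ, c < fSigma σ t := by
  obtain ⟨_, ⟨t, ht, rfl⟩, h⟩ := exists_lt_of_lt_csSup ((openSimplex_nonempty ℓ).image (fSigma σ)) hc
  exact ⟨t, ht, h⟩

/-- If `f_σ ≤ C` on the whole open simplex then `M_σ ≤ C`. -/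
theorem fSup_le_of_forall_le {C : ℝ} (h : ∀ t ∈ openSimplex ℓ, fSigma σ t ≤ C) : fSup σ ≤ C :=
  csSup_le ((openSimplex_nonempty ℓ).image _) (by rintro _ ⟨t, ht, rfl⟩; exact h t ht)

/-! ### Superlevel sets of `f_σ` -/

/-- The superlevel set `{t ∈ S : c < f_σ(t)}` is open. -/
theorem isOpen_superlevel (hσi : Function.Injective σ) (c : ℝ) :
    IsOpen (openSimplex ℓ ∩ fSigma σ ⁻¹' Ioi c) :=
  (continuousOn_fSigma σ hσi).isOpen_inter_preimage (isOpen_openSimplex ℓ) isOpen_Ioi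

/-- For `c < M_σ` the superlevel set `{f_σ > c}` has positive volume. -/
theorem volume_superlevel_pos (hσ : Function.Bijective σ) {c : ℝ} (hc : c < fSup σ) :
    0 < volume (openSimplex ℓ ∩ fSigma σ ⁻¹' Ioi c) := by
  obtain ⟨t, ht, h⟩ := exists_lt_fSigma σ hc
  exact (isOpen_superlevel σ hσ.1 c).measure_pos volume ⟨t, ht, h⟩

/-! ### Comparison of `f_σ^N ω_σ` with `ω_σ` -/

/-- `f_σ^N ω_σ = f_σ^N · ω_σ` pointwise: `basic σ N t = f_σ(t)^N · basic σ 0 t` (`N ∈ ℕ`). -/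
theorem basic_natCast_eq (N : ℕ) (t : Fin ℓ → ℝ) : basic σ (N : ℤ) t = fSigma σ t ^ N * basic σ 0 t := by
  rw [basic_eq, basic_eq, zpow_natCast, zpow_zero]
  change fSigma σ t ^ N / formDen σ t = fSigma σ t ^ N * (1 / formDen σ t)
  rw [mul_one_div]

/-- **`I_σ(N) ≤ M_σ^N · I_σ(0)`** for every bijective seating and every `N ∈ ℕ` (both sides are the junk value `0`
when `σ` is not convergent). -/
theorem integral_basic_le_fSup_pow (hσ : Function.Bijective σ) (N : ℕ) :
    integral σ (fun _ => (N : ℤ)) (fun _ => (N : ℤ)) ≤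
      fSup σ ^ N * integral σ (fun _ => (0 : ℤ)) (fun _ => (0 : ℤ)) := by
  by_cases hc : Convergent σ
  · have h0 : IntegrableOn (basic σ 0) (openSimplex ℓ) := integrableOn_basic_of_convergent σ hσ hc le_rfl
    have hN : IntegrableOn (basic σ (N : ℤ)) (openSimplex ℓ) :=
      integrableOn_basic_of_convergent σ hσ hc (Int.natCast_nonneg N)
    unfold integral
    rw [← integral_const_mul]
    refine setIntegral_mono_on hN (h0.const_mul _) (measurableSet_openSimplex ℓ) fun t ht => ?_
    change basic σ (N : ℤ) t ≤ fSup σ ^ N * basic σ 0 t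
    rw [basic_natCast_eq]
    exact mul_le_mul_of_nonneg_right
      (pow_le_pow_left₀ (fSigma_pos σ hσ.1 ht).le (fSigma_le_fSup σ hσ ht) N)
      (integrand_pos hσ.1 _ _ ht).le
  · have h0 : ¬ IntegrableOn (basic σ 0) (openSimplex ℓ) :=
      fun h => hc ((integrableOn_basic_iff_convergent σ hσ le_rfl).1 h)
    have hN : ¬ IntegrableOn (basic σ (N : ℤ)) (openSimplex ℓ) :=
      fun h => hc ((integrableOn_basic_iff_convergent σ hσ (Int.natCast_nonneg N)).1 h)
    have h0' : ¬ Integrable (integrand σ (fun _ => (0 : ℤ)) (fun _ => (0 : ℤ))) (volume.restrict (openSimplex ℓ)) :=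
      h0
    have hN' : ¬ Integrable (integrand σ (fun _ => (N : ℤ)) (fun _ => (N : ℤ))) (volume.restrict (openSimplex ℓ)) :=
      hN
    unfold integral
    rw [integral_undef h0', integral_undef hN', mul_zero]

/-- **Lower bound from a superlevel set**: `c^N · ∫_{S ∩ {f_σ > c}} ω_σ ≤ I_σ(N)` for a convergent seating, `0 ≤ c`,
`N ∈ ℕ`. -/
theorem superlevel_integral_le (hσ : Function.Bijective σ) (hc : Convergent σ) {c : ℝ} (hc0 : 0 ≤ c) (N : ℕ) :
    c ^ N * ∫ t in openSimplex ℓ ∩ fSigma σ ⁻¹' Ioi c, basic σ 0 t ≤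
      integral σ (fun _ => (N : ℤ)) (fun _ => (N : ℤ)) := by
  set U := openSimplex ℓ ∩ fSigma σ ⁻¹' Ioi c with hUdef
  have hU : MeasurableSet U := (isOpen_superlevel σ hσ.1 c).measurableSet
  have hUS : U ⊆ openSimplex ℓ := inter_subset_left
  have h0 : IntegrableOn (basic σ 0) (openSimplex ℓ) := integrableOn_basic_of_convergent σ hσ hc le_rfl
  have hN : IntegrableOn (basic σ (N : ℤ)) (openSimplex ℓ) :=
    integrableOn_basic_of_convergent σ hσ hc (Int.natCast_nonneg N)
  have hnn : 0 ≤ᵐ[volume.restrict (openSimplex ℓ)] basic σ (N : ℤ) :=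
    (ae_restrict_iff' (measurableSet_openSimplex ℓ)).2 (ae_of_all _ fun t ht => (integrand_pos hσ.1 _ _ ht).le)
  calc c ^ N * ∫ t in U, basic σ 0 t = ∫ t in U, c ^ N * basic σ 0 t := (integral_const_mul _ _).symm
    _ ≤ ∫ t in U, basic σ (N : ℤ) t := by
        refine setIntegral_mono_on ((h0.mono_set hUS).const_mul _) (hN.mono_set hUS) hU fun t ht => ?_
        rw [basic_natCast_eq]
        exact mul_le_mul_of_nonneg_right (pow_le_pow_left₀ hc0 (le_of_lt (mem_Ioi.1 ht.2)) N)
          (integrand_pos hσ.1 _ _ ht.1).le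
    _ ≤ ∫ t in openSimplex ℓ, basic σ (N : ℤ) t := setIntegral_mono_set hN hnn hUS.eventuallyLE
    _ = integral σ (fun _ => (N : ℤ)) (fun _ => (N : ℤ)) := rfl

/-- For `c < M_σ` and a convergent seating, `0 < ∫_{S ∩ {f_σ > c}} ω_σ`. -/
theorem superlevel_integral_pos (hσ : Function.Bijective σ) (hc : Convergent σ) {c : ℝ} (hcM : c < fSup σ) :
    0 < ∫ t in openSimplex ℓ ∩ fSigma σ ⁻¹' Ioi c, basic σ 0 t := by
  set U := openSimplex ℓ ∩ fSigma σ ⁻¹' Ioi c with hUdef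
  have hU : MeasurableSet U := (isOpen_superlevel σ hσ.1 c).measurableSet
  have hint : IntegrableOn (basic σ 0) U :=
    (integrableOn_basic_of_convergent σ hσ hc le_rfl).mono_set inter_subset_left
  have hnn : 0 ≤ᵐ[volume.restrict U] basic σ 0 :=
    (ae_restrict_iff' hU).2 (ae_of_all _ fun t ht => (integrand_pos hσ.1 _ _ ht.1).le)
  rw [setIntegral_pos_iff_support_of_nonneg_ae hnn hint]
  have : Function.support (basic σ 0) ∩ U = U := by
    ext t
    simp only [mem_inter_iff, Function.mem_support, and_iff_right_iff_imp]
    exact fun ht => (integrand_pos hσ.1 _ _ ht.1).ne'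
  rw [this]
  exact volume_superlevel_pos σ hσ hcM

/-! ### The root asymptotics `I_σ(N)^{1/N} → M_σ` -/

/-- `(x^N · y)^{1/N} = x · y^{1/N}` for `x, y ≥ 0`, `N ≥ 1`. -/
theorem root_pow_mul {x y : ℝ} (hx : 0 ≤ x) (hy : 0 ≤ y) {N : ℕ} (hN : N ≠ 0) :
    (x ^ N * y) ^ (1 / (N : ℝ)) = x * y ^ (1 / (N : ℝ)) := by
  rw [Real.mul_rpow (pow_nonneg hx N) hy, one_div, Real.pow_rpow_inv_natCast hx hN]

/-- `a · b^{1/N} → a` as `N → ∞`, for `b > 0`. -/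
theorem tendsto_const_mul_root (a : ℝ) {b : ℝ} (hb : 0 < b) :
    Tendsto (fun N : ℕ => a * b ^ (1 / (N : ℝ))) atTop (𝓝 a) := by
  have h1 : Tendsto (fun N : ℕ => b ^ (1 / (N : ℝ))) atTop (𝓝 1) := by
    have h := ((Real.continuousAt_const_rpow (b := 0) hb.ne').tendsto).comp
      (tendsto_one_div_atTop_nhds_zero_nat (𝕜 := ℝ))
    rw [Real.rpow_zero] at h
    exact h
  simpa using (tendsto_const_nhds (x := a)).mul h1

/-- The basic cellular integrals of a convergent seating are positive. -/
theorem integral_basic_pos (hσ : Function.Bijective σ) (hc : Convergent σ) (N : ℕ) :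
    0 < integral σ (fun _ => (N : ℤ)) (fun _ => (N : ℤ)) :=
  integral_pos hσ.1 _ _ (integrableOn_basic_of_convergent σ hσ hc (Int.natCast_nonneg N))
    (volume_openSimplex_ne_zero ℓ)

/-- **The growth constant**: for a CONVERGENT bijective seating `σ`, `I_σ(N)^{1/N} → M_σ = sup_S f_σ` as
`N → ∞`.  (Upper bound `I_σ(N) ≤ M_σ^N I_σ(0)`; lower bound `I_σ(N) ≥ c^N ∫_{f_σ > c} ω_σ` for every `c < M_σ`,
the superlevel set being a non-empty open set.) [Brown2016, §1.5 objects; structural] -/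
theorem tendsto_integral_basic_root (hσ : Function.Bijective σ) (hc : Convergent σ) :
    Tendsto (fun N : ℕ => (integral σ (fun _ => (N : ℤ)) (fun _ => (N : ℤ))) ^ (1 / (N : ℝ)))
      atTop (𝓝 (fSup σ)) := by
  set I : ℕ → ℝ := fun N => integral σ (fun _ => (N : ℤ)) (fun _ => (N : ℤ)) with hI
  have hIpos : ∀ N, 0 < I N := fun N => integral_basic_pos σ hσ hc N
  have hI0 : I 0 = integral σ (fun _ => (0 : ℤ)) (fun _ => (0 : ℤ)) := by simp only [hI, Nat.cast_zero]
  have hM := fSup_pos σ hσ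
  rw [tendsto_order]
  constructor
  · intro a ha
    -- pick `c` with `max a 0 < c < M_σ`
    obtain ⟨c, hac, hcM⟩ := exists_between (max_lt ha hM)
    have hc0 : 0 ≤ c := ((le_max_right a 0).trans_lt hac).le
    have hac' : a < c := (le_max_left a 0).trans_lt hac
    set J := ∫ t in openSimplex ℓ ∩ fSigma σ ⁻¹' Ioi c, basic σ 0 t with hJ
    have hJpos : 0 < J := superlevel_integral_pos σ hσ hc hcM
    have hlow : ∀ N : ℕ, N ≠ 0 → c * J ^ (1 / (N : ℝ)) ≤ I N ^ (1 / (N : ℝ)) := by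
      intro N hN
      rw [← root_pow_mul hc0 hJpos.le hN]
      exact Real.rpow_le_rpow (by positivity) (superlevel_integral_le σ hσ hc hc0 N) (by positivity)
    have hev : ∀ᶠ N : ℕ in atTop, a < c * J ^ (1 / (N : ℝ)) :=
      (tendsto_order.1 (tendsto_const_mul_root c hJpos)).1 a hac'
    filter_upwards [hev, eventually_ne_atTop 0] with N h1 h2
    exact h1.trans_le (hlow N h2)
  · intro b hb
    have hup : ∀ N : ℕ, N ≠ 0 → I N ^ (1 / (N : ℝ)) ≤ fSup σ * (I 0) ^ (1 / (N : ℝ)) := by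
      intro N hN
      rw [← root_pow_mul hM.le (hIpos 0).le hN]
      refine Real.rpow_le_rpow (hIpos N).le ?_ (by positivity)
      rw [hI0]
      exact integral_basic_le_fSup_pow σ hσ N
    have hev : ∀ᶠ N : ℕ in atTop, fSup σ * (I 0) ^ (1 / (N : ℝ)) < b :=
      (tendsto_order.1 (tendsto_const_mul_root (fSup σ) (hIpos 0))).2 b hb
    filter_upwards [hev, eventually_ne_atTop 0] with N h1 h2
    exact (hup N h2).trans_lt h1

/-- Logarithmic form: **`(log I_σ(N)) / N → log M_σ`** for a convergent bijective seating — the decay exponent of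
the basic cellular family is `−log M_σ`. -/
theorem tendsto_log_integral_basic_div (hσ : Function.Bijective σ) (hc : Convergent σ) :
    Tendsto (fun N : ℕ => Real.log (integral σ (fun _ => (N : ℤ)) (fun _ => (N : ℤ))) / N)
      atTop (𝓝 (Real.log (fSup σ))) := by
  have h := ((Real.continuousAt_log (fSup_pos σ hσ).ne').tendsto).comp (tendsto_integral_basic_root σ hσ hc)
  refine h.congr fun N => ?_
  simp only [Function.comp_apply]
  rw [Real.log_rpow (integral_basic_pos σ hσ hc N)]
  ring

end Summit.KontsevichZagierPeriods.Zeta5Search.Families.Cellular
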